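import Summits.AtomisticToContinuum.Crystallization.Theorems.FrustratedLawDichotomyStrainedPatchHomEntryFitHcpCentredSqSound

/-!
# The ROBUST squared centred pair verdict `fitOKHDCRSρ` and its soundness in ROBUST CORE FORM (27623 `(H) HomFloor (1/625)`, hcp half; lens-5 g90,
# port item PT-2 of NODE 90 «ParamTransfer»)

decomp-a2c lens-5 g90 (crux `AperiodicFrustratedLawGap`, stmt-AtomisticToContinuum-27623).  The kit of record `…CentredSqKit.fitOKHDCRS c w q` certifies, on
the parameter box `(c, w)` (entries of `U`, shuffle `ξ`), the eleven real core hypotheses of `…HomEntryFitHcpRotReal.goodAtScale_of_fitBounds_hcp_eta_minR`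
(lens-5 g90 `…CentredSqCore.fitOKHDCRS_core`).  ★ `fitOKHDCRSρ c w q ρS e0S` is the same verdict read out ROBUSTLY with a collar budget `ρ = ρS/SC` and a
pair-residual NORM bound `e₀ = e0S/SC`: (a) the pair test runs over the possibly-minimising scales `k′` of record (`…MinPairs.possMinH`, unchanged —
the minimal scale VALUE is `1`-Lipschitz in the shuffle, so no near-minimising set is needed); (b) the squared centred rotated pair enclosure `cPairCRS` (the
sharp branch of `cPairOKRS`) is tested against `e0S²` in NORM form (`B.hi·SC ≤ e0S²`);
(c) the budget `e₀ + 2ρ ≤ 4999/100000·(dlo − ρ)`; (d) the clean gap with slack `23/10·ρ`, the far shells with slacks `13/10·ρ` (A) / `23/10·ρ` (B);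
(e) `0 ≤ ρ < dlo`, `dhi + ρ ≤ 3/2`.  ★★ `fitOKHDCRSρ_sound`: for every self-adjoint `U` in the entry box and every `ξ` in the shuffle box, `‖ξ‖ ≤ 1/2` and the
TWELVE clauses of NODE 90's `…HomParamTransfer.HcpFitCoreRobust U ξ R (4999/100000) (dEnclH.lo/SC) (dEnclH.hi/SC) (ρS/SC) (e0S/SC)` hold (spelled out, so
that this file does not depend on the node file; the bridge is `exact` by `δ`-unfolding) — hence, by `HcpFitCoreRobust.shift` / `hcpLeafGoal_of_collar_coord`
(NODE 90 §4–§5), the goodness core transfers to every `ξ′` with `‖U (ξ′ − ξ)‖ ≤ ρ`: a THIN certified box serves a FAT leaf (`fatLeaf`, memo NODE-g90 §3 PT-3).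
At `ρS = 0` the verdict is `fitOKHDCRS`'s sharp branch with the pair threshold in norm form.

* §1 kit: `cPairOKRSe`, ★ `fitOKHDCRSρ` (computable; `decide`-able like `fitOKHDCRS`);
* §2 ★ `norm_pair_le_of_cPairOKRSe` (from `…CentredSqPair.norm_pair_sq_le_cPairCoreRS`), ★★ `fitOKHDCRSρ_sound` (proof = `fitOKHDCRS_sound`'s chain with the
  five bullets re-targeted; folklore chaining).

Two computable definitions + theorems; 0 sorry; standard axioms; no instances / notation / `#eval`.  `--supports stmt-AtomisticToContinuum-27623 --as helper`.
-/

namespace Summit.AtomisticToContinuum.Crystallization.Theorems.FrustratedLawDichotomyStrainedPatchHomEntryFitHcpCentred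

open scoped BigOperators RealInnerProductSpace Matrix
open Summit.AtomisticToContinuum.Crystallization.Theorems.FrustratedLawDichotomyStrainedPatchHomOrthogonal (exists_linearIsometry_of_orthogonal)
open Literature.Analysis.ValidatedNumerics.Numerics
open Literature.Geometry.DiscreteGeometry (hcpKissingPattern)
open Literature.Geometry.DiscreteGeometry.ShellCensus (hcpTuple hcpTuple_injective)
open Summit.AtomisticToContinuum.Crystallization.Theorems.ChargedEnergyGapNegative (E3)
open Summit.AtomisticToContinuum.Crystallization.Theorems.FrustratedLawDichotomySchurCut (effPot w₄₅ ω₄)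
open Summit.AtomisticToContinuum.Crystallization.Theorems.FrustratedLawDichotomyMotifLemmas (GoodAtScale)
open Summit.AtomisticToContinuum.Crystallization.Theorems.FrustratedLawDichotomyAveragingRuleTightFree (TightNearCap BadNearCap)
open Summit.AtomisticToContinuum.Crystallization.Theorems.FrustratedLawDichotomyExemptAbsorption (ExemptNear)
open Summit.AtomisticToContinuum.Crystallization.Theorems.FrustratedLawDichotomyStrainedPatchHomSplit
open Summit.AtomisticToContinuum.Crystallization.Theorems.FrustratedLawDichotomyStrainedPatchHomGram (norm_sq_latPt_eq_sum_gram norm_sq_latPt_add_eq_sum_gram)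
open Summit.AtomisticToContinuum.Crystallization.Theorems.FrustratedLawDichotomyStrainedPatchHomLatticeBox (norm_apply_ge_of_near_one latPt_zero)
open Summit.AtomisticToContinuum.Crystallization.Theorems.FrustratedLawDichotomyStrainedPatchHomLatticeBoxHcp
  (latPt_eq_apply_one shifted_eq_apply mem_box_of_norm_hexPt_lt mem_box_of_norm_hexPt_add_shift_lt)
open Summit.AtomisticToContinuum.Crystallization.Theorems.FrustratedLawDichotomyStrainedPatchHomPrunesFit (goodAtScale_centre_of_fit_hcpPattern)
open Summit.AtomisticToContinuum.Crystallization.Theorems.FrustratedLawDichotomyAveragingCut (self_mem_ball)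
open Summit.AtomisticToContinuum.Crystallization.Theorems.FrustratedLawDichotomyStrainedPatchHomPrunes (locHom_hcp_centre)
open Summit.AtomisticToContinuum.Crystallization.Theorems.FrustratedLawDichotomyStrainedPatchHomPrunedPolar (homFloor_of_prunedBoxSums_selfAdjoint)
open Summit.AtomisticToContinuum.Crystallization.Theorems.FrustratedLawDichotomyStrainedPatchHomLeafCheckC (iccC iccC_eq)
open Summit.AtomisticToContinuum.Crystallization.Theorems.FrustratedLawDichotomyStrainedPatchHomCertTree (CertTree treeOK)
open Summit.AtomisticToContinuum.Crystallization.Theorems.FrustratedLawDichotomyStrainedPatchHomEntryGram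
open Summit.AtomisticToContinuum.Crystallization.Theorems.FrustratedLawDichotomyStrainedPatchHomEntryFitKit (lmin lmin_le_of_mem lmin_mem)
open Summit.AtomisticToContinuum.Crystallization.Theorems.FrustratedLawDichotomyStrainedPatchHomEntryFit (scaleL devFI entryLeafOKF fccHalf_of_entryFitTree lmax le_lmax_of_mem)
open Summit.AtomisticToContinuum.Crystallization.Theorems.FrustratedLawDichotomyStrainedPatchHomEntryGramHcp
open Summit.AtomisticToContinuum.Crystallization.Theorems.FrustratedLawDichotomyStrainedPatchHomEntryHcpFrame
open Summit.AtomisticToContinuum.Crystallization.Theorems.FrustratedLawDichotomyTwoShellRigidityAssemblyDial (hcpTuple_mem exists_hcpTuple_eq)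
open Summit.AtomisticToContinuum.Crystallization.Theorems.FrustratedLawDichotomyStrainedPatchHomLatticeBoxHcp (latPt_eq_apply_one)
open Summit.AtomisticToContinuum.Crystallization.Theorems.FrustratedLawDichotomyStrainedPatchHomEntryFit (scaleL devFI lmax le_lmax_of_mem)
open Summit.AtomisticToContinuum.Crystallization.Theorems.FrustratedLawDichotomyStrainedPatchHomEntryFitHcpKit
open Summit.AtomisticToContinuum.Crystallization.Theorems.FrustratedLawDichotomyStrainedPatchHomEntryFitHcp
open Summit.AtomisticToContinuum.Crystallization.Theorems.FrustratedLawDichotomyStrainedPatchHomEntrySearch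
open Summit.AtomisticToContinuum.Crystallization.Theorems.FrustratedLawDichotomyStrainedPatchHomEntrySign (entryLeafOKD fccHalf_of_entrySearchDom)
open Summit.AtomisticToContinuum.Crystallization.Theorems.FrustratedLawDichotomyStrainedPatchHomEntryFitHcpSharpKit
open Summit.AtomisticToContinuum.Crystallization.Theorems.FrustratedLawDichotomyStrainedPatchHomEntryFitHcpSharp

open Summit.AtomisticToContinuum.Crystallization.Theorems.FrustratedLawDichotomyStrainedPatchHomEntryFitHcpSharpEta
open Summit.AtomisticToContinuum.Crystallization.Theorems.FrustratedLawDichotomyStrainedPatchHomPrunedPolar (homFloor_of_prunedBoxSums_selfAdjoint)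
open Summit.AtomisticToContinuum.Crystallization.Theorems.FrustratedLawDichotomyStrainedPatchHomEntryGram (rootC rootW)
open Summit.AtomisticToContinuum.Crystallization.Theorems.FrustratedLawDichotomyStrainedPatchHomEntryGramHcp (rootCH rootWH)
open Summit.AtomisticToContinuum.Crystallization.Theorems.FrustratedLawDichotomyStrainedPatchHomEntryTable (muRec muRec_ok)
open Summit.AtomisticToContinuum.Crystallization.Theorems.FrustratedLawDichotomyStrainedPatchHomEntryTableP (entryLeafOK6RBKP)
open Summit.AtomisticToContinuum.Crystallization.Theorems.FrustratedLawDichotomyStrainedPatchHomEntryTreeCert (fccHalf_of_entryTree6RBKP)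
open Summit.AtomisticToContinuum.Crystallization.Theorems.FrustratedLawDichotomyStrainedPatchHomEntryFlipHcp (HcpDich hcpHalf_of_entryTreeShuf)
open Summit.AtomisticToContinuum.Crystallization.Theorems.FrustratedLawDichotomyStrainedPatchHomEntrySymBox (symH hbox_symU)
open Summit.AtomisticToContinuum.Crystallization.Theorems.FrustratedLawDichotomyStrainedPatchHomEntryQuickHcp (entryLeafOKHQ entryLeafOKHQ_imp)
open Summit.AtomisticToContinuum.Crystallization.Theorems.FrustratedLawDichotomyStrainedPatchHomLeafTableCheckHcpV (entryLeafOKHVK_sound)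
open Summit.AtomisticToContinuum.Crystallization.Theorems.FrustratedLawDichotomyStrainedPatchHomCurvLeafHCC (entryLeafOKHCCX entryLeafOKHCCX_sound)
open Summit.AtomisticToContinuum.Crystallization.Theorems.FrustratedLawDichotomyStrainedPatchHomEntryLeafHT
  (HTCert entryLeafOKHT4 entryLeafOKHT4_sound)
open Summit.AtomisticToContinuum.Crystallization.Theorems.FrustratedLawDichotomyStrainedPatchHomEntryFitTolerance (cT090 cT095 wU12X12 wU11X11)

/-! ## §1 The robust kit -/

/-- The squared centred rotated pair enclosure `cPairCRS` tested in NORM form against `e0S`: `B.hi·SC ≤ e0S²`. -/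
def cPairOKRSe (c w : (Fin 3 × Fin 3) ⊕ Fin 3 → ℤ) (L : ℤ) (q : Fin 4 → ℤ) (k k' : Fin 12) (e0S : ℤ) : Bool :=
  (cPairCRS c w L q k k').elim false fun B => decide (B.hi * (SC : ℤ) ≤ e0S ^ 2)

/-- ★ **THE ROBUST SQUARED CENTRED FIT VERDICT** `fitOKHDCRSρ c w q ρS e0S` (collar budget `ρS/SC`, pair-residual norm bound `e0S/SC`). -/
def fitOKHDCRSρ (c w : (Fin 3 × Fin 3) ⊕ Fin 3 → ℤ) (q : Fin 4 → ℤ) (ρS e0S : ℤ) : Bool :=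
  let L := scaleL (fun ab => c (Sum.inl ab))
  let D := dEnclH c w
  decide (c (Sum.inl (1, 0)) = c (Sum.inl (0, 1)) ∧ c (Sum.inl (2, 0)) = c (Sum.inl (0, 2)) ∧ c (Sum.inl (2, 1)) = c (Sum.inl (1, 2))) &&
  decide (0 ≤ L) && decide (0 < D.lo) && decide (D.lo ≤ D.hi) && decide (2 * (D.hi + ρS) ≤ 3 * (SC : ℤ)) &&
  decide (0 ≤ ρS) && decide (ρS < D.lo) && decide (0 ≤ e0S) && decide (0 ≤ 130 * D.lo - (SC : ℤ) - 230 * ρS) &&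
  decide (4 * (xiSq c w).hi ≤ (SC : ℤ)) && decide (100000 * (e0S + 2 * ρS) ≤ 4999 * (D.lo - ρS)) &&
  decide (0 < cayN q) && K12H.all (fun k => K12H.all fun k' => !possMinH c w k' || cPairOKRSe c w L q k k' e0S) &&
  K12H.all (fun k => decide ((nbrSq c w k).hi * SC * 10000 ≤ (130 * D.lo - SC - 230 * ρS) ^ 2)) &&
  decide (∀ b ∈ box7all,
    (b = 0 ∨ (∃ k : Fin 12, hshift k = false ∧ hlab k = b) ∨ (130 * D.hi + (SC : ℤ) + 130 * ρS) ^ 2 ≤ (qform13 (extU c w) b false).lo * SC * 10000) ∧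
    ((∃ k : Fin 12, hshift k = true ∧ hlab k = b) ∨ (130 * D.hi + (SC : ℤ) + 230 * ρS) ^ 2 ≤ (qform13 (extU c w) b true).lo * SC * 10000))

/-! ## §2 Soundness -/

/-- ★ The pair bound in NORM form from `cPairOKRSe`: `‖nbrU k − ‖nbrU k′‖•R(nbr k)‖ ≤ e0S/SC`. [folklore chaining on `norm_pair_sq_le_cPairCoreRS`] -/
theorem norm_pair_le_of_cPairOKRSe {c w : (Fin 3 × Fin 3) ⊕ Fin 3 → ℤ}
    (hsym : c (Sum.inl (1, 0)) = c (Sum.inl (0, 1)) ∧ c (Sum.inl (2, 0)) = c (Sum.inl (0, 2)) ∧ c (Sum.inl (2, 1)) = c (Sum.inl (1, 2)))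
    (U : E3 →L[ℝ] E3) (ξ : E3) (hsa : ∀ v v' : E3, ⟪U v, v'⟫ = ⟪v, U v'⟫)
    (hbox : ∀ ab : Fin 3 × Fin 3, |(U (EuclideanSpace.single ab.2 (1 : ℝ))) ab.1 - (c (Sum.inl ab) : ℝ) / SC| ≤ (w (Sum.inl ab) : ℝ) / SC)
    (hξb : ∀ i : Fin 3, |ξ i - (c (Sum.inr i) : ℝ) / SC| ≤ (w (Sum.inr i) : ℝ) / SC) (k k' : Fin 12)
    (q : Fin 4 → ℤ) (Riso : E3 →ₗᵢ[ℝ] E3) (hRiso : ∀ (x : E3) (i : Fin 3), Riso x i = ∑ j, cayQ q i j * x j) (hNq : 0 < cayN q)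
    {e0S : ℤ} (he0 : 0 ≤ e0S) (hOK : cPairOKRSe c w (scaleL (fun ab => c (Sum.inl ab))) q k k' e0S = true) :
    ‖nbrU U ξ k - ‖nbrU U ξ k'‖ • Riso (nbr k)‖ ≤ (e0S : ℝ) / SC := by
  have hS : (0 : ℝ) < SC := SC_pos
  obtain ⟨B, hB, htest⟩ := elim_false_eq_true hOK
  unfold cPairCRS at hB
  obtain ⟨e, he, hB⟩ := Option.bind_eq_some_iff.1 hB
  obtain ⟨g, hg, hB⟩ := Option.bind_eq_some_iff.1 hB
  have hcore := norm_pair_sq_le_cPairCoreRS hsym U ξ hsa hbox hξb k k' q Riso hRiso hNq he hg hB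
  rw [decide_eq_true_eq] at htest
  have ht' : ((B.hi : ℤ) : ℝ) * SC ≤ (e0S : ℝ) ^ 2 := by exact_mod_cast htest
  have he0' : (0 : ℝ) ≤ e0S := by exact_mod_cast he0
  have hsq : (‖nbrU U ξ k - ‖nbrU U ξ k'‖ • Riso (nbr k)‖ * SC) ^ 2 ≤ (e0S : ℝ) ^ 2 := by
    have e1 : (‖nbrU U ξ k - ‖nbrU U ξ k'‖ • Riso (nbr k)‖ * SC) ^ 2 = ‖nbrU U ξ k - ‖nbrU U ξ k'‖ • Riso (nbr k)‖ ^ 2 * SC * SC := by ring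
    rw [e1]
    nlinarith [hcore, ht', hS]
  have hle := (abs_le_of_sq_le_sq' hsq he0').2
  rwa [le_div_iff₀ hS]

/-- ★★ **SOUNDNESS OF `fitOKHDCRSρ` IN ROBUST CORE FORM**: `‖ξ‖ ≤ 1/2` and the twelve clauses of NODE 90's
`HcpFitCoreRobust U ξ R (4999/100000) (dEnclH.lo/SC) (dEnclH.hi/SC) (ρS/SC) (e0S/SC)`, spelled out. [folklore chaining; `fitOKHDCRS_sound` re-targeted] -/
theorem fitOKHDCRSρ_sound {c w : (Fin 3 × Fin 3) ⊕ Fin 3 → ℤ} {q : Fin 4 → ℤ} {ρS e0S : ℤ} (h : fitOKHDCRSρ c w q ρS e0S = true) (U : E3 →L[ℝ] E3) (ξ : E3)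
    (hsa : ∀ v v' : E3, ⟪U v, v'⟫ = ⟪v, U v'⟫)
    (hbox : ∀ ab : Fin 3 × Fin 3, |(U (EuclideanSpace.single ab.2 (1 : ℝ))) ab.1 - (c (Sum.inl ab) : ℝ) / SC| ≤ (w (Sum.inl ab) : ℝ) / SC)
    (hξb : ∀ i : Fin 3, |ξ i - (c (Sum.inr i) : ℝ) / SC| ≤ (w (Sum.inr i) : ℝ) / SC) :
    ‖ξ‖ ≤ 1 / 2 ∧ ∃ (R : E3 →ₗᵢ[ℝ] E3),
      0 ≤ (4999 / 100000 : ℝ) ∧ (4999 / 100000 : ℝ) < 1 / 20 ∧ 0 ≤ (ρS : ℝ) / SC ∧ (ρS : ℝ) / SC < ((dEnclH c w).lo : ℝ) / SC ∧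
      ((dEnclH c w).hi : ℝ) / SC + (ρS : ℝ) / SC ≤ 3 / 2 ∧
      (∀ k, ((dEnclH c w).lo : ℝ) / SC ≤ ‖nbrU U ξ k‖) ∧ (∃ k, ‖nbrU U ξ k‖ ≤ ((dEnclH c w).hi : ℝ) / SC) ∧
      (∀ k k', (∀ j, ‖nbrU U ξ k'‖ ≤ ‖nbrU U ξ j‖) → ‖nbrU U ξ k - ‖nbrU U ξ k'‖ • R (nbr k)‖ ≤ (e0S : ℝ) / SC) ∧
      (e0S : ℝ) / SC + 2 * ((ρS : ℝ) / SC) ≤ 4999 / 100000 * (((dEnclH c w).lo : ℝ) / SC - (ρS : ℝ) / SC) ∧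
      (∀ k, ‖nbrU U ξ k‖ ≤ 13 / 10 * (((dEnclH c w).lo : ℝ) / SC) - 1 / 100 - 23 / 10 * ((ρS : ℝ) / SC)) ∧
      (∀ b ∈ (Fintype.piFinset fun _ : Fin 3 => Finset.Icc (-7 : ℤ) 7), b ≠ 0 → (∀ k, hshift k = false → hlab k ≠ b) →
        13 / 10 * (((dEnclH c w).hi : ℝ) / SC) + 1 / 100 + 13 / 10 * ((ρS : ℝ) / SC) ≤ ‖latPt U hexFrame b‖) ∧
      (∀ b ∈ (Fintype.piFinset fun _ : Fin 3 => Finset.Icc (-7 : ℤ) 7), (∀ k, hshift k = true → hlab k ≠ b) →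
        13 / 10 * (((dEnclH c w).hi : ℝ) / SC) + 1 / 100 + 23 / 10 * ((ρS : ℝ) / SC) ≤ ‖latPt U hexFrame b + U (hcpShift + ξ)‖) := by
  simp only [fitOKHDCRSρ, Bool.and_eq_true, decide_eq_true_eq, List.all_eq_true] at h
  obtain ⟨⟨⟨⟨⟨⟨⟨⟨⟨⟨⟨⟨⟨⟨hsymm, hL0⟩, h0⟩, h01⟩, h32⟩, hρ0⟩, hρd⟩, he0⟩, h130⟩, hxi4⟩, hbud⟩, hNq⟩, hpair⟩, hK⟩, hfar⟩ := h
  obtain ⟨Riso, hRiso⟩ := exists_linearIsometry_of_orthogonal (cayQ q) (cayQ_orthogonal q hNq)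
  have hS := SC_pos
  have hne := SC_ne
  -- enclosures of the extended Gram data of `U` and of the shuffle
  have hE : ∀ ab : Fin 3 × Fin 3, FI.mem ((U (EuclideanSpace.single ab.2 (1 : ℝ))) ab.1) (entU c w ab) := fun ab => mem_entryFI (hbox ab)
  have hX : ∀ i, FI.mem (ξ i) (shufFI c w i) := fun i => mem_shufFI (hξb i)
  obtain ⟨hUG, hUC, hUT⟩ : (∀ i j, FI.mem ⟪U (hexFrame i), U (hexFrame j)⟫ (extU c w (Sum.inl (i, j)))) ∧
      (∀ i, FI.mem ⟪U (hexFrame i), U (hcpShift + ξ)⟫ (extU c w (Sum.inr (Sum.inl i)))) ∧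
      FI.mem (‖U (hcpShift + ξ)‖ ^ 2) (extU c w (Sum.inr (Sum.inr 0))) := mem_extFI U ξ hE hX
  have hnbr : ∀ k, FI.mem (‖nbrU U ξ k‖ ^ 2) (nbrSq c w k) := fun k => by
    have := mem_qform13 U (hcpShift + ξ) hUG hUC hUT (hlab k) (hshift k)
    unfold nbrU nbrSq; exact this
  -- `‖ξ‖ ≤ 1/2`
  have hxi : FI.mem (‖ξ‖ ^ 2) (xiSq c w) := by
    rw [EuclideanSpace.norm_sq_eq, Fin.sum_univ_three]
    simp only [Real.norm_eq_abs, sq_abs]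
    exact FI.mem_add (FI.mem_add (FI.mem_sqr (hX 0)) (FI.mem_sqr (hX 1))) (FI.mem_sqr (hX 2))
  have hξ2 : ‖ξ‖ ≤ 1 / 2 := by
    have h1 := (FI.mem_def.1 hxi).2
    have h2 : (4 : ℝ) * (xiSq c w).hi ≤ SC := by exact_mod_cast hxi4
    have hsq : ‖ξ‖ ^ 2 ≤ (1 / 2) ^ 2 := by
      have := le_of_mul_le_mul_right (by linarith : ‖ξ‖ ^ 2 * 4 * SC ≤ 1 * SC) hS
      linarith
    exact (abs_le_of_sq_le_sq' hsq (by norm_num)).2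
  -- the minimum and its enclosures
  obtain ⟨k₀, -, hk₀⟩ := Finset.exists_min_image Finset.univ (fun k : Fin 12 => ‖nbrU U ξ k‖) Finset.univ_nonempty
  have hd_le : ∀ k, ‖nbrU U ξ k₀‖ ≤ ‖nbrU U ξ k‖ := fun k => hk₀ k (Finset.mem_univ k)
  have hd0 : 0 ≤ ‖nbrU U ξ k₀‖ := norm_nonneg _
  have hDsq_lo : ∀ k, ((dSqH c w).lo : ℝ) ≤ ‖nbrU U ξ k‖ ^ 2 * SC := fun k => by
    have h1 : lmin (K12H.map fun k => (nbrSq c w k).lo) ≤ (nbrSq c w k).lo := lmin_le_of_mem _ _ (List.mem_map.2 ⟨k, mem_K12H k, rfl⟩)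
    have h1' : ((lmin (K12H.map fun k => (nbrSq c w k).lo) : ℤ) : ℝ) ≤ (nbrSq c w k).lo := by exact_mod_cast h1
    exact h1'.trans (FI.mem_def.1 (hnbr k)).1
  have hmemDsq : FI.mem (‖nbrU U ξ k₀‖ ^ 2) (dSqH c w) := by
    refine ⟨hDsq_lo k₀, ?_⟩
    have hl : (K12H.map fun k => (nbrSq c w k).hi) ≠ [] := by simp [K12H]
    obtain ⟨k', _, he⟩ := List.mem_map.1 (lmin_mem _ hl)
    have h2 := (FI.mem_def.1 (hnbr k')).2
    have hle := mul_le_mul_of_nonneg_right (pow_le_pow_left₀ hd0 (hd_le k') 2) hS.le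
    show ‖nbrU U ξ k₀‖ ^ 2 * SC ≤ (((dSqH c w).hi : ℤ) : ℝ)
    rw [show (dSqH c w).hi = lmin (K12H.map fun k => (nbrSq c w k).hi) from rfl, ← he]
    linarith
  have hmemD : FI.mem ‖nbrU U ξ k₀‖ (dEnclH c w) := by
    have := FI.mem_sqrt hmemDsq
    rwa [Real.sqrt_sq hd0] at this
  obtain ⟨hDlo, hDhi⟩ := FI.mem_def.1 hmemD
  have h0' : (0 : ℝ) < (dEnclH c w).lo := by exact_mod_cast h0
  have hρ0' : (0 : ℝ) ≤ ρS := by exact_mod_cast hρ0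
  refine ⟨hξ2, Riso, by norm_num, by norm_num, div_nonneg hρ0' hS.le, ?_, ?_, ?_, ?_, ?_, ?_, ?_, ?_, ?_⟩
  · -- ρ < dlo
    have : (ρS : ℝ) < (dEnclH c w).lo := by exact_mod_cast hρd
    exact div_lt_div_of_pos_right this hS
  · -- dhi + ρ ≤ 3/2
    have : (2 : ℝ) * ((dEnclH c w).hi + ρS) ≤ 3 * SC := by exact_mod_cast h32
    rw [← add_div, div_le_iff₀ hS]
    linarith
  · -- (d) lower
    intro k
    have := mul_le_mul_of_nonneg_right (hd_le k) hS.le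
    rw [div_le_iff₀ hS]
    linarith
  · -- (d) upper
    exact ⟨k₀, by rw [le_div_iff₀ hS]; exact hDhi⟩
  · -- (F1) the pair bound in norm form, for possibly-minimising scales `k'` (filter of record)
    intro k k' hk'
    have hposs : possMinH c w k' = true := by
      unfold possMinH
      rw [decide_eq_true_eq]
      have hl : (K12H.map fun k => (nbrSq c w k).hi) ≠ [] := by simp [K12H]
      obtain ⟨j', _, he⟩ := List.mem_map.1 (lmin_mem _ hl)
      have h1 := (FI.mem_def.1 (hnbr k')).1
      have h2 := (FI.mem_def.1 (hnbr j')).2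
      have hle := mul_le_mul_of_nonneg_right (pow_le_pow_left₀ (norm_nonneg _) (hk' j') 2) hS.le
      have key : (((nbrSq c w k').lo : ℤ) : ℝ) ≤ ((lmin (K12H.map fun k => (nbrSq c w k).hi) : ℤ) : ℝ) := by
        rw [← he]
        linarith
      have key' : (nbrSq c w k').lo ≤ lmin (K12H.map fun k => (nbrSq c w k).hi) := by exact_mod_cast key
      exact key'
    have hp := hpair k (mem_K12H k) k' (mem_K12H k')
    rw [hposs] at hp
    exact norm_pair_le_of_cPairOKRSe hsymm U ξ hsa hbox hξb k k' q Riso hRiso hNq he0 (by simpa using hp)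
  · -- budget
    have hb : (100000 : ℝ) * (e0S + 2 * ρS) ≤ 4999 * ((dEnclH c w).lo - ρS) := by exact_mod_cast hbud
    have e1 : (e0S : ℝ) / SC + 2 * ((ρS : ℝ) / SC) = ((e0S : ℝ) + 2 * ρS) / SC := by ring
    have e2 : (4999 : ℝ) / 100000 * (((dEnclH c w).lo : ℝ) / SC - (ρS : ℝ) / SC) = 4999 / 100000 * (((dEnclH c w).lo : ℝ) - ρS) / SC := by ring
    rw [e1, e2, div_le_div_iff_of_pos_right hS]
    linarith
  · -- (F2) clean gap with slack `23/10·ρ`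
    intro k
    have f3 := hK k (mem_K12H k)
    have hC := (FI.mem_def.1 (hnbr k)).2
    have f3' : ((nbrSq c w k).hi : ℝ) * SC * 10000 ≤ (130 * (dEnclH c w).lo - SC - 230 * ρS) ^ 2 := by exact_mod_cast f3
    have h130' : (0 : ℝ) ≤ 130 * (dEnclH c w).lo - SC - 230 * ρS := by exact_mod_cast h130
    have hC' := mul_le_mul_of_nonneg_right hC (by positivity : (0 : ℝ) ≤ SC * 10000)
    have hsq : (‖nbrU U ξ k‖ * (100 * SC)) ^ 2 ≤ ((130 : ℝ) * (dEnclH c w).lo - SC - 230 * ρS) ^ 2 := by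
      have e : (‖nbrU U ξ k‖ * (100 * SC)) ^ 2 = ‖nbrU U ξ k‖ ^ 2 * SC * (SC * 10000) := by ring
      rw [e]; linarith
    have hle := (abs_le_of_sq_le_sq' hsq h130').2
    rw [show (13 : ℝ) / 10 * (((dEnclH c w).lo : ℝ) / SC) - 1 / 100 - 23 / 10 * ((ρS : ℝ) / SC) =
        (130 * ((dEnclH c w).lo : ℝ) - SC - 230 * ρS) / (100 * SC) by field_simp; ring,
      le_div_iff₀ (by positivity)]
    exact hle
  · -- (F3) far, family A, slack `13/10·ρ`
    intro b hb hb0 hnot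
    rw [← box7all_eq] at hb
    obtain ⟨hA, _⟩ := hfar b hb
    rcases hA with rfl | ⟨k, hk, he⟩ | f4
    · exact (hb0 rfl).elim
    · exact (hnot k hk he).elim
    · have f4' : ((130 : ℝ) * (dEnclH c w).hi + SC + 130 * ρS) ^ 2 ≤ ((qform13 (extU c w) b false).lo : ℝ) * SC * 10000 := by exact_mod_cast f4
      have hm := mem_qform13 U (hcpShift + ξ) hUG hUC hUT b false
      simp only [Bool.false_eq_true, ↓reduceIte, add_zero] at hm
      have hC := (FI.mem_def.1 hm).1
      have hC' := mul_le_mul_of_nonneg_right hC (by positivity : (0 : ℝ) ≤ SC * 10000)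
      have hsq : ((130 : ℝ) * (dEnclH c w).hi + SC + 130 * ρS) ^ 2 ≤ (‖latPt U hexFrame b‖ * (100 * SC)) ^ 2 := by
        have e : (‖latPt U hexFrame b‖ * (100 * SC)) ^ 2 = ‖latPt U hexFrame b‖ ^ 2 * SC * (SC * 10000) := by ring
        rw [e]; linarith
      have hle := (abs_le_of_sq_le_sq' hsq (by positivity)).2
      rw [show (13 : ℝ) / 10 * (((dEnclH c w).hi : ℝ) / SC) + 1 / 100 + 13 / 10 * ((ρS : ℝ) / SC) =
          (130 * ((dEnclH c w).hi : ℝ) + SC + 130 * ρS) / (100 * SC) by field_simp; ring,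
        div_le_iff₀ (by positivity)]
      exact hle
  · -- (F3) far, family B, slack `23/10·ρ`
    intro b hb hnot
    rw [← box7all_eq] at hb
    obtain ⟨_, hB⟩ := hfar b hb
    rcases hB with ⟨k, hk, he⟩ | f4
    · exact (hnot k hk he).elim
    · have f4' : ((130 : ℝ) * (dEnclH c w).hi + SC + 230 * ρS) ^ 2 ≤ ((qform13 (extU c w) b true).lo : ℝ) * SC * 10000 := by exact_mod_cast f4
      have hm := mem_qform13 U (hcpShift + ξ) hUG hUC hUT b true
      simp only [↓reduceIte] at hm
      have hC := (FI.mem_def.1 hm).1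
      have hC' := mul_le_mul_of_nonneg_right hC (by positivity : (0 : ℝ) ≤ SC * 10000)
      have hsq : ((130 : ℝ) * (dEnclH c w).hi + SC + 230 * ρS) ^ 2 ≤ (‖latPt U hexFrame b + U (hcpShift + ξ)‖ * (100 * SC)) ^ 2 := by
        have e : (‖latPt U hexFrame b + U (hcpShift + ξ)‖ * (100 * SC)) ^ 2 = ‖latPt U hexFrame b + U (hcpShift + ξ)‖ ^ 2 * SC * (SC * 10000) := by
          ring
        rw [e]; linarith
      have hle := (abs_le_of_sq_le_sq' hsq (by positivity)).2
      rw [show (13 : ℝ) / 10 * (((dEnclH c w).hi : ℝ) / SC) + 1 / 100 + 23 / 10 * ((ρS : ℝ) / SC) =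
          (130 * ((dEnclH c w).hi : ℝ) + SC + 230 * ρS) / (100 * SC) by field_simp; ring,
        div_le_iff₀ (by positivity)]
      exact hle

end Summit.AtomisticToContinuum.Crystallization.Theorems.FrustratedLawDichotomyStrainedPatchHomEntryFitHcpCentred
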